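import Mathlib
import HarnessLib

/-!
# Crux `PatternPricedCertificates` (stmt-AtomisticToContinuum-12974), line `registered` —
# stub `stub_banachLimit`: a generalised (Banach-type) limit on real sequences

This file discharges the registered stub `stub_banachLimit` of line `registered` for crux
stmt-AtomisticToContinuum-12974
(`Summit.AtomisticToContinuum.Crystallization.Theses.FrustrationRangeCertificates.PatternPricedCertificates`).

**Statement.** There is a functional `Λ : (ℕ → ℝ) → ℝ` which is additive and homogeneous on *all*
real sequences, nonnegative on `[0, 1]`-valued sequences, normalised (`Λ 1 = 1`), and vanishes on
every eventually-zero sequence.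

**Proof (folklore; ultrafilter limit + linear extension).**
* `banachLimit_exists_tendsto`: a bounded sequence converges along the free ultrafilter
  `Filter.hyperfilter ℕ` (its image ultrafilter contains the compact interval `[-M, M]`,
  `IsCompact.ultrafilter_le_nhds'`).
* On the subspace `W` of bounded sequences the ultrafilter limit `L` is well defined
  (`tendsto_nhds_unique`), additive and homogeneous (`Tendsto.add`, `Tendsto.const_mul`), so it is a
  linear map `W →ₗ[ℝ] ℝ`; it is nonnegative on `[0, 1]`-valued sequences (the limit lies in the
  closed set `[0, ∞)`), sends the constant sequence `1` to `1`, and kills eventually-zero sequences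
  (they vanish on a cofinite set, which belongs to the hyperfilter, `Filter.hyperfilter_le_cofinite`).
* `LinearMap.exists_extend` extends `L` to a linear map on all of `ℕ → ℝ`; the extension agrees with
  `L` on `W`, which carries all the remaining clauses.

No new definitions; nothing is assumed. [folklore]
-/

noncomputable section

open scoped BigOperators Classical

namespace Summit.AtomisticToContinuum.Crystallization.Theorems.PatternPricedCertificates

open Filter Topology

/-- A bounded real sequence converges along the free ultrafilter `hyperfilter ℕ`: the image
ultrafilter contains the compact interval `[-M, M]`, hence converges to a point of it. [folklore] -/
theorem banachLimit_exists_tendsto {a : ℕ → ℝ} {M : ℝ} (hM : ∀ n, |a n| ≤ M) :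
    ∃ l : ℝ, Tendsto a (↑(hyperfilter ℕ) : Filter ℕ) (𝓝 l) := by
  have hmem : Set.Icc (-M) M ∈ Ultrafilter.map a (hyperfilter ℕ) :=
    Ultrafilter.mem_map.2 (univ_mem' fun n => Set.mem_preimage.2 (Set.mem_Icc.2 (abs_le.1 (hM n))))
  obtain ⟨l, -, hl⟩ := isCompact_Icc.ultrafilter_le_nhds' _ hmem
  refine ⟨l, ?_⟩
  rw [Ultrafilter.coe_map] at hl
  exact hl

/-- An eventually-zero real sequence is bounded (by the sum of the absolute values of its first
`n₀` terms). [folklore] -/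
theorem banachLimit_bounded_of_eventually_zero {a : ℕ → ℝ} {n₀ : ℕ}
    (h : ∀ n, n₀ ≤ n → a n = 0) : ∀ n, |a n| ≤ ∑ i ∈ Finset.range n₀, |a i| := by
  intro n
  by_cases hn : n₀ ≤ n
  · rw [h n hn, abs_zero]
    exact Finset.sum_nonneg fun i _ => abs_nonneg (a i)
  · exact Finset.single_le_sum (f := fun i => |a i|) (fun i _ => abs_nonneg (a i))
      (Finset.mem_range.2 (lt_of_not_ge hn))

/-- An eventually-zero real sequence tends to `0` along the free ultrafilter `hyperfilter ℕ`
(it vanishes on a cofinite set, and the hyperfilter refines the cofinite filter). [folklore] -/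
theorem banachLimit_tendsto_zero_of_eventually_zero {a : ℕ → ℝ} {n₀ : ℕ}
    (h : ∀ n, n₀ ≤ n → a n = 0) : Tendsto a (↑(hyperfilter ℕ) : Filter ℕ) (𝓝 0) := by
  have hcof : ∀ᶠ n in (cofinite : Filter ℕ), a n = 0 := by
    rw [Nat.cofinite_eq_atTop]
    exact (eventually_ge_atTop n₀).mono h
  have hev : ∀ᶠ n in (↑(hyperfilter ℕ) : Filter ℕ), (fun _ : ℕ => (0 : ℝ)) n = a n :=
    (hcof.filter_mono hyperfilter_le_cofinite).mono fun n hn => hn.symm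
  exact tendsto_const_nhds.congr' hev

/-- **Generalised (Banach-type) limit.** There is a functional `Λ` on all real sequences which is
additive, homogeneous, nonnegative on `[0, 1]`-valued sequences, normalised (`Λ 1 = 1`) and vanishes
on eventually-zero sequences. It is the ultrafilter limit along `hyperfilter ℕ` on bounded
sequences, extended linearly (`LinearMap.exists_extend`) to all sequences. [folklore] -/
theorem stub_banachLimit :
    ∃ Λ : (ℕ → ℝ) → ℝ,
      (∀ a b : ℕ → ℝ, Λ (a + b) = Λ a + Λ b) ∧ (∀ (t : ℝ) (a : ℕ → ℝ), Λ (t • a) = t * Λ a) ∧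
      (∀ a : ℕ → ℝ, (∀ n, 0 ≤ a n ∧ a n ≤ 1) → 0 ≤ Λ a) ∧ Λ (fun _ => 1) = 1 ∧
      ∀ a : ℕ → ℝ, (∃ n₀ : ℕ, ∀ n, n₀ ≤ n → a n = 0) → Λ a = 0 := by
  -- the subspace of bounded sequences
  let W : Submodule ℝ (ℕ → ℝ) :=
    { carrier := {a | ∃ M : ℝ, ∀ n, |a n| ≤ M}
      add_mem' := by
        rintro a b ⟨M, hM⟩ ⟨N, hN⟩
        exact ⟨M + N, fun n => (abs_add_le (a n) (b n)).trans (add_le_add (hM n) (hN n))⟩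
      zero_mem' := ⟨0, fun n => by simp⟩
      smul_mem' := by
        rintro t a ⟨M, hM⟩
        refine ⟨|t| * M, fun n => ?_⟩
        rw [Pi.smul_apply, smul_eq_mul, abs_mul]
        exact mul_le_mul_of_nonneg_left (hM n) (abs_nonneg t) }
  have hW : ∀ {a : ℕ → ℝ} {M : ℝ}, (∀ n, |a n| ≤ M) → a ∈ W := fun {a M} hM => ⟨M, hM⟩
  -- the ultrafilter limit on `W`
  have hlim : ∀ a : W, ∃ l : ℝ, Tendsto (a : ℕ → ℝ) (↑(hyperfilter ℕ) : Filter ℕ) (𝓝 l) := by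
    rintro ⟨a, M, hM⟩
    exact banachLimit_exists_tendsto hM
  choose L hL using hlim
  have hLeq : ∀ (a : W) (l : ℝ), Tendsto (a : ℕ → ℝ) (↑(hyperfilter ℕ) : Filter ℕ) (𝓝 l) →
      L a = l := fun a l h => tendsto_nhds_unique (hL a) h
  -- `L` is linear on `W`
  let Lmap : W →ₗ[ℝ] ℝ :=
    { toFun := L
      map_add' := fun a b => hLeq (a + b) _ ((hL a).add (hL b))
      map_smul' := fun t a => by
        rw [RingHom.id_apply, smul_eq_mul]
        exact hLeq (t • a) _ ((hL a).const_mul t) }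
  have hLmap : ∀ a : W, Lmap a = L a := fun a => rfl
  -- extend linearly to all sequences
  obtain ⟨g, hg⟩ := LinearMap.exists_extend Lmap
  have hgW : ∀ (a : ℕ → ℝ) (ha : a ∈ W) (l : ℝ),
      Tendsto a (↑(hyperfilter ℕ) : Filter ℕ) (𝓝 l) → g a = l := by
    intro a ha l hl
    have hga : g a = L ⟨a, ha⟩ := by
      have := LinearMap.congr_fun hg ⟨a, ha⟩
      rw [LinearMap.comp_apply, Submodule.subtype_apply, hLmap] at this
      exact this
    rw [hga]
    exact hLeq ⟨a, ha⟩ l hl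
  refine ⟨g, fun a b => map_add g a b, fun t a => by rw [map_smul, smul_eq_mul], ?_, ?_, ?_⟩
  · -- nonnegativity on `[0, 1]`-valued sequences
    intro a ha
    have haW : a ∈ W :=
      hW (M := 1) fun n => abs_le.2 ⟨by linarith [(ha n).1], (ha n).2⟩
    rw [hgW a haW _ (hL ⟨a, haW⟩)]
    exact isClosed_Ici.mem_of_tendsto (hL ⟨a, haW⟩)
      (Eventually.of_forall fun n => Set.mem_Ici.2 (ha n).1)
  · -- normalisation
    exact hgW _ (hW (M := 1) fun n => by simp) 1 tendsto_const_nhds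
  · -- eventually-zero sequences
    rintro a ⟨n₀, hn₀⟩
    exact hgW a (hW (banachLimit_bounded_of_eventually_zero hn₀)) 0
      (banachLimit_tendsto_zero_of_eventually_zero hn₀)

end Summit.AtomisticToContinuum.Crystallization.Theorems.PatternPricedCertificates

end
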